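import Literature.AlgebraicGeometry.HodgeTheory.MotivatedClassesProofs
import Literature.AlgebraicGeometry.HodgeTheory.AlgebraicClassesPullbackHolds
import Literature.AlgebraicGeometry.Motives.SegreEmbedding
import Literature.AlgebraicGeometry.HodgeTheory.StandardConjectureAOfHodgeClasses
import Literature.AlgebraicGeometry.HodgeTheory.HardLefschetzNFoldHolds
import Literature.AlgebraicGeometry.HodgeTheory.AlgebraicClassesCupDivisorHolds
import Literature.AlgebraicGeometry.HodgeTheory.LefschetzOneOneHolds
import Literature.AlgebraicGeometry.HodgeTheory.MotivatedClassesCupPairingNondegenerate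
import Literature.AlgebraicGeometry.HodgeTheory.AbelianVarietyEndomorphismsHOne
import Literature.AlgebraicGeometry.HodgeTheory.HomologicalNumericalEquivalenceOfLefschetzStandard
import HarnessLib

/-!
# `B(X) ⇒ A(X)` and `A(X) ⇒ D(X)`: the cup pairing on algebraic classes is non-degenerate under Grothendieck's conjecture A

For `X` smooth projective of dimension `n` over `ℂ`:

* Part 1 — `map_mem_algebraicClasses_of_isAlgebraicCorrespondence`: algebraic correspondences preserve algebraic classes
  (Voisin II Prop. 9.21 with (10.7), fed with the tree's theorem `Voisin2003_cupProduct_algebraicClasses_holds'`).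
* Part 2 — `standardConjectureA_of_standardConjectureBStar`: `B(X)` in the `⋆_L`-form (`StandardConjectureBStar n X η`) implies
  Grothendieck's `A(X, η)` (`StandardConjectureA n X η`) for every polarisation class `η` (Grothendieck 1968 §3: `Lʳ : N^p → N^{n-p}`
  is onto because `⋆_L` is an algebraic correspondence and algebraic correspondences preserve algebraic classes);
  `forall_standardConjectureA_of_forall_standardConjectureBStar`.
* Part 3 — Kleiman's `A(X) ∧ (algebraic classes are Hodge) ⇒ D(X)`, graded: Lefschetz operators on algebraic classes with
  explicit target degrees (`lefschetzPowTo_mem_supportedClasses`, `exists_lefschetzPowTo_eq_of_surjOn`), the primitive components of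
  an algebraic class are algebraic granted the surjectivity clause of `A` below its codimension
  (`primitivePart_lefschetzPowTo_mem_supportedClasses`, `primitivePart_mem_supportedClasses_of_surjOn_lt`,
  `lefschetzPowTo_primitivePart_mem_algebraicClasses_of_surjOn_lt`), and "hom ≡ num" on algebraic classes:
  `eq_zero_of_forall_cupProduct_algebraic_eq_zero_of_surjOn_lt`, `…_of_standardConjectureA`, `…_of_standardConjectureA'`
  (second Hodge–Riemann relation on classes of pure type `(p,p)` for the Kähler class of a Kähler–rational datum), packaged as
  `nondegenerate_algebraicClasses_of_standardConjectureA`: if `A(X, η)` holds for every polarisation class then the cup pairing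
  `N^p(X) × N^q(X) → H^{2n}(X(ℂ); ℂ)` (`p + q = n`) is non-degenerate on both sides.

Theorems only; no definition, no named fact; nothing here asserts a case of the Hodge conjecture or of the standard conjectures.

## References

* [Grothendieck1968] A. Grothendieck, Standard conjectures on algebraic cycles (Bombay 1968), §3 p. 196 (B(X) ⇒ A(X)).
* [Kleiman1968AlgebraicCycles] S. Kleiman, Algebraic cycles and the Weil conjectures (1968), §2, §3 Prop. 3.8, Cor. 3.9.
* [VoisinHodgeI2002] C. Voisin, Hodge Theory and Complex Algebraic Geometry I, §6.2.3 Cor. 6.26, §6.3.2 Thm. 6.32.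
* [VoisinHodgeII2003] C. Voisin, Hodge Theory and Complex Algebraic Geometry II, §9.2.4 Prop. 9.20–9.21, (10.7).

Provenance: Literature home (namespace `Literature.AlgebraicGeometry.HodgeTheory.AbelianPencil`) of the used declarations of the
Summits-side `HodgeConjecture/Theorems/Ring2AbelianAllAndreFibreClass (1/27)`, `…/Ring2AbelianAllStandardAPencils (2/22)` and
`…/Ring2AbelianAllAndreStandardANumerical (9/13)`
(namespace `…Ring2.AbelianAll`; imports `Literature/` and Mathlib only), re-homed verbatim towards the Literature-side discharge of
`Abdulali1994.Abdulali1994_invariantCycles_of_lefschetzStandard{,A}`; `isPolarizationClass_Hη` and `conjClass_mem_algebraicClasses` of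
the source are replaced by the existing Literature theorems `KaehlerRationalDatum.isPolarizationClass_Hη` and
`HodgeTheory.conjClass_mem_algebraicClasses`, and `exists_polarizationForm_eq_trace_cupProduct` is the Literature
`MotivatedAlgebra.exists_polarizationForm_eq_trace_cupProduct`. Layer 2/4 (independent of layer 1; `Literature/` and Mathlib imports only).
-/

noncomputable section

namespace Literature.AlgebraicGeometry.HodgeTheory.AbelianPencil

/-! ## Part 1: Algebraic correspondences preserve algebraic classes (Voisin II Prop. 9.21) -/

section Part1

open _root_.CategoryTheory _root_.AlgebraicGeometry MonoidalCategory
open Literature.AlgebraicGeometry Literature.AlgebraicGeometry.Motives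
open Literature.AlgebraicGeometry.HodgeTheory

variable {𝒳 S : SchemeOver ℂ}

/-- **An algebraic correspondence maps algebraic classes to algebraic classes** (Voisin II, Prop. 9.21
with (10.7): `cl(Γ_*(Z)) = [Γ]_*(cl Z)`; Fulton §19.2): for `T : H²ᵖ(X(ℂ)) → H^{2q}(W(ℂ))` induced by an
algebraic class on `W × X` (`IsAlgebraicCorrespondence m n W X T`, `W`, `X` smooth projective of dimensions `m`,
`n`), `T(Nᵖ H²ᵖ(X)) ⊆ N^q H^{2q}(W)`. The tree's reduction `corrClassAction_mem_algebraicClasses_of_cupProduct`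
(flat pull-back, cup product, Gysin push-forward) fed with the PROVED multiplicativity of algebraic classes
`Voisin2003_cupProduct_algebraicClasses_holds'` on `W ⊗ X`. No hypothesis.
[cite: VoisinHodgeII2003, §9.2.4 Prop. 9.20–9.21 and (10.7)] [cite: Fulton1998, §19.2 Cor. 19.2 and §16.1] -/
theorem map_mem_algebraicClasses_of_isAlgebraicCorrespondence {m n : ℕ} {W X : SchemeOver ℂ}
    (hW : IsSmoothProjective m W) (hX : IsSmoothProjective n X) {p q : ℕ}
    {T : complexBetti X (2 * p) →ₗ[ℂ] complexBetti W (2 * q)} (hT : IsAlgebraicCorrespondence m n W X T)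
    {c : complexBetti X (2 * p)} (hc : c ∈ algebraicClasses X p) : T c ∈ algebraicClasses W q := by
  obtain ⟨μ, ν, -, hν, e, k, hab, hq, γ, hγ, rfl⟩ := hT
  exact corrClassAction_mem_algebraicClasses_of_cupProduct hW hX μ ν hν hab hq
    (fun x y hx hy ↦ Voisin2003_cupProduct_algebraicClasses_holds'
      (IsSmoothProjective.tensor_holds hW hX) hx hy) hγ hc

end Part1

/-! ## Part 2: Grothendieck's `B(X) ⇒ A(X)` on the real carriers -/

section Part2

open _root_.CategoryTheory _root_.AlgebraicGeometry MonoidalCategory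
open Literature.AlgebraicGeometry Literature.AlgebraicGeometry.Motives
open Literature.AlgebraicGeometry.HodgeTheory

/-! ## §0 Grothendieck's `B(X) ⇒ A(X)` on the real carriers (unconditional) -/

/-- **`B(X)` in André's `⋆_L`-form implies Grothendieck's `A(X, η)`, on the real carriers** (Grothendieck, Bombay
1968, §3 p. 196: "`B(X) ⇒ A(X)`"; Kleiman 1968 §2). For `X` smooth projective of dimension `n` and a polarisation
class `η`: (a) hard Lefschetz is part of `IsPolarizationClass`; (b) for `2p + r = n`, `p + r = q`, `Lʳ` maps
`Nᵖ H²ᵖ` into `N^q H^{2p+2r}` (`lefschetzPow_mapsTo_algebraicClasses`, unconditional), is injective (hard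
Lefschetz), and is ONTO: for `y ∈ N^q H^{2p+2r}`, `x := ⋆_L y ∈ H²ᵖ` is algebraic because `⋆_L : H^{2q} → H^{2p}` is
an algebraic correspondence (`B(X)`) and algebraic correspondences preserve algebraic classes
(`map_mem_algebraicClasses_of_isAlgebraicCorrespondence`, Voisin II Prop. 9.21 with the tree's theorem
`Voisin2003_cupProduct_algebraicClasses_holds`), and `Lʳ x = y` (`lefschetzPow_lefschetzInvolution`). No hypothesis
beyond `B(X)`. [cite: Grothendieck1968, §3 p. 196 (B(X) ⇒ A(X))] [cite: Kleiman1968AlgebraicCycles, §2]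
[cite: VoisinHodgeII2003, §9.2.4 Prop. 9.20–9.21 and (10.7)] -/
theorem standardConjectureA_of_standardConjectureBStar {n : ℕ} {X : SchemeOver ℂ} {η : complexBetti X 2}
    (hX : IsSmoothProjective n X) (hη : IsPolarizationClass n X η) (hB : StandardConjectureBStar n X η) :
    StandardConjectureA n X η := by
  refine ⟨hη.hasHardLefschetz, fun p r q hpr hq ↦ ⟨?_, ?_, ?_⟩⟩
  · exact lefschetzPow_mapsTo_algebraicClasses hX hη.mem_algebraicClasses hq
  · exact (hη.hasHardLefschetz r (2 * p) hpr).1.injOn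
  · -- onto: `x := ⋆_L y` is algebraic and `Lʳ x = y`
    have key : ∀ {i : ℕ} (z : complexBetti X i), z ∈ supportedClasses X i q → ∀ (hi : i = 2 * q)
        (hab : i + 2 * p = 2 * n), lefschetzInvolution hη.hasHardLefschetz hab z ∈ algebraicClasses X p := by
      intro i z hz hi hab
      subst hi
      exact map_mem_algebraicClasses_of_isAlgebraicCorrespondence hX hX (hB hη (2 * q) (2 * p) hab) hz
    intro y hy
    have hab : 2 * p + 2 * r + 2 * p = 2 * n := by omega
    exact ⟨lefschetzInvolution hη.hasHardLefschetz hab y, key y hy (by omega) hab,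
      lefschetzPow_lefschetzInvolution hη.hasHardLefschetz hpr hab y⟩

/-- `B(X)` in `⋆_L`-form for every `η` gives `A(X, η)` for every polarisation class `η` (the quantifier shapes of the
cell's pencil nodes). [cite: Grothendieck1968, §3 p. 196 (B(X) ⇒ A(X))] -/
theorem forall_standardConjectureA_of_forall_standardConjectureBStar {n : ℕ} {X : SchemeOver ℂ}
    (hX : IsSmoothProjective n X) (hB : ∀ η : complexBetti X 2, StandardConjectureBStar n X η) :
    ∀ η : complexBetti X 2, IsPolarizationClass n X η → StandardConjectureA n X η :=
  fun η hη ↦ standardConjectureA_of_standardConjectureBStar hX hη (hB η)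

end Part2

/-! ## Part 3: Kleiman's `A(X) ⇒ D(X)`: non-degeneracy of the cup pairing on algebraic classes -/

section Part3

open _root_.CategoryTheory _root_.AlgebraicGeometry
open Literature.AlgebraicGeometry Literature.AlgebraicGeometry.Motives
open Literature.AlgebraicGeometry.HodgeTheory
open Literature.AlgebraicTopology.SingularHomology (cupProduct cupProduct_gradedComm_holds)
open Literature.Geometry.Kaehler (lefschetzPow HasHardLefschetzProperty)

section Kleiman

variable {n : ℕ} {X : SchemeOver ℂ}

/-! ## §1 Iterated Lefschetz operators on algebraic classes; `A(X, κ)` with an explicit target degree -/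

/-- `L_κʲ` maps `Nˡ H^{2l}` into `N^{l+j} Hᵐ` (`κ ∈ N¹`; explicit target degree `m = 2l + 2j`).
[cite: VoisinHodgeII2003, §9.2.4 Prop. 9.20] -/
theorem lefschetzPowTo_mem_supportedClasses (hX : IsSmoothProjective n X) {κ : complexBetti X 2}
    (hκ : κ ∈ algebraicClasses X 1) {k l : ℕ} (hk : 2 * l = k) {c : complexBetti X k}
    (hc : c ∈ supportedClasses X k l) (j m : ℕ) (hm : k + 2 * j = m) :
    lefschetzPowTo κ j k m hm c ∈ supportedClasses X m (l + j) := by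
  subst hk
  subst hm
  rw [lefschetzPowTo_eq_lefschetzPow]
  exact lefschetzPow_mem_supportedClasses_of_mem hX hκ l hc j

/-- Surjectivity of `Lʳ : Nᵖ → N^{p+r}` with an explicit target degree `m = 2p + 2r`.
[cite: Grothendieck1968, §3 p. 196 (A(X))] -/
theorem exists_lefschetzPowTo_eq_of_surjOn {κ : complexBetti X 2} {p r m : ℕ}
    (h : Set.SurjOn (lefschetzPow κ r (2 * p)) (algebraicClasses X p : Set (complexBetti X (2 * p)))
      (supportedClasses X (2 * p + 2 * r) (p + r)))
    (hm : 2 * p + 2 * r = m) {y : complexBetti X m} (hy : y ∈ supportedClasses X m (p + r)) :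
    ∃ x ∈ algebraicClasses X p, lefschetzPowTo κ r (2 * p) m hm x = y := by
  subst hm
  obtain ⟨x, hx, hxy⟩ := h hy
  exact ⟨x, hx, hxy⟩

/-- **Shift step.** If every Lefschetz component `ξ_Q x''` of `x'' ∈ H^{i''}` is algebraic of codimension `r'' - t_Q`,
and `a_Q + t_Q + e ≤ n` for all indices `Q`, then every Lefschetz component of `Lᵉ x''` is algebraic of codimension
`r'' + e - t` (the components of `Lᵉ x''` are those of `x''`, shifted: uniqueness of the Lefschetz decomposition).
[cite: VoisinHodgeI2002, §6.2.3 Cor. 6.26] -/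
theorem primitivePart_lefschetzPowTo_mem_supportedClasses {κ : complexBetti X 2} (hL : HasHardLefschetzProperty κ n)
    (hvan : ∀ m, 2 * n < m → Subsingleton (complexBetti X m)) {i'' i e r'' : ℕ} (hi : i'' + 2 * e = i)
    {x'' : complexBetti X i''}
    (hx'' : ∀ Q : {Q : ℕ × ℕ // Q.1 + 2 * Q.2 = i''},
      primitivePart κ n hL hvan Q x'' ∈ supportedClasses X Q.1.1 (r'' - Q.1.2))
    (he : ∀ Q : {Q : ℕ × ℕ // Q.1 + 2 * Q.2 = i''}, Q.1.1 + Q.1.2 + e ≤ n)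
    (P : {P : ℕ × ℕ // P.1 + 2 * P.2 = i}) :
    primitivePart κ n hL hvan P (lefschetzPowTo κ e i'' i hi x'') ∈ supportedClasses X P.1.1 (r'' + e - P.1.2) := by
  classical
  -- `Lᵉ x'' = Σ_Q L^{t_Q + e} ξ_Q x''`
  have hsum : lefschetzPowTo κ e i'' i hi x'' =
      ∑ Q : {Q : ℕ × ℕ // Q.1 + 2 * Q.2 = i''},
        lefschetzPowTo κ (Q.1.2 + e) Q.1.1 i (by have := Q.2; omega) (primitivePart κ n hL hvan Q x'') := by
    conv_lhs => rw [← sum_lefschetzPowTo_primitivePart hL hvan x'']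
    rw [map_sum]
    refine Finset.sum_congr rfl fun Q _ ↦ ?_
    exact lefschetzPowTo_lefschetzPowTo κ e Q.2 hi _ _
  rw [hsum, map_sum]
  refine Submodule.sum_mem _ fun Q _ ↦ ?_
  have hQ2 := Q.2
  have hPQ2 : Q.1.1 + 2 * (Q.1.2 + e) = i := by omega
  have hmem : lefschetzPowTo κ (Q.1.2 + e) Q.1.1 i hPQ2 (primitivePart κ n hL hvan Q x'') ∈
      lefschetzSummand κ n i ⟨(Q.1.1, Q.1.2 + e), hPQ2⟩ :=
    lefschetzPowTo_mem_lefschetzSummand hPQ2 (primitivePart_mem hL hvan Q x'')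
  by_cases hP : P = ⟨(Q.1.1, Q.1.2 + e), hPQ2⟩
  · subst hP
    rw [primitivePart_lefschetzPowTo_of_mem hL hvan ⟨(Q.1.1, Q.1.2 + e), hPQ2⟩
      (by have := he Q; dsimp only; omega) (primitivePart_mem hL hvan Q x'')]
    change primitivePart κ n hL hvan Q x'' ∈ supportedClasses X Q.1.1 (r'' + e - (Q.1.2 + e))
    rw [show r'' + e - (Q.1.2 + e) = r'' - Q.1.2 by omega]
    exact hx'' Q
  · rw [primitivePart_eq_zero_of_mem_ne hL hvan (fun h ↦ hP h.symm) hmem]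
    exact Submodule.zero_mem _

/-- **KLEIMAN, GRADED: THE PRIMITIVE COMPONENTS OF AN ALGEBRAIC CLASS OF CODIMENSION `r` ARE ALGEBRAIC as soon as the
surjectivity clause of `A(X, κ)` holds in the codimensions `p' < r` with `p' + r ≤ n`** (so UNCONDITIONALLY for `r ≤ 2` and for
`r ≥ n - 1`, where only `p' ≤ 1` is asked — Lefschetz `(1,1)` —, part XVIII-i). For `X` smooth projective of dimension `n`
and `κ ∈ N¹ H²(X(ℂ); ℂ)` with the hard Lefschetz property, every algebraic class `x ∈ Nʳ H^{2r}` then has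
`ξ_{(a,t)} x ∈ N^{r-t} Hᵃ` for every Lefschetz index `(a, t)`, `a + 2t = 2r`. (For `2r ≤ n`: `L^{n-2r+1} x ∈
N^{n-r+1} = L^{n-2r+2} N^{r-1}` by `A`, so `x = x₀ + L x₁`, `x₀` primitive algebraic, `x₁ ∈ N^{r-1}`, and induct; for
`2r > n`: `x = L^{2r-n} x'`, `x' ∈ N^{n-r}`, by `A`.) [cite: Kleiman1968AlgebraicCycles, §3 (proof of Prop. 3.8)]
[cite: Grothendieck1968, §3 p. 196] [cite: VoisinHodgeI2002, §6.2.3 Cor. 6.26] -/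
theorem primitivePart_mem_supportedClasses_of_surjOn_lt (hX : IsSmoothProjective n X) {κ : complexBetti X 2}
    (hκ : κ ∈ algebraicClasses X 1) (hL : HasHardLefschetzProperty κ n)
    (hvan : ∀ m, 2 * n < m → Subsingleton (complexBetti X m)) :
    ∀ (r : ℕ), (∀ (p' r' q' : ℕ), p' < r → p' + r ≤ n → 2 * p' + r' = n → p' + r' = q' →
        Set.SurjOn (lefschetzPow κ r' (2 * p')) (algebraicClasses X p' : Set (complexBetti X (2 * p')))
          (supportedClasses X (2 * p' + 2 * r') q')) →
      ∀ (x : complexBetti X (2 * r)), x ∈ algebraicClasses X r →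
      ∀ P : {P : ℕ × ℕ // P.1 + 2 * P.2 = 2 * r},
        primitivePart κ n hL hvan P x ∈ supportedClasses X P.1.1 (r - P.1.2) := by
  classical
  intro r
  induction r using Nat.strong_induction_on with
  | _ r ih =>
  intro hA x hx P
  have hP2 := P.2
  rcases le_or_gt (2 * r) n with hr | hr
  · -- degrees `2r ≤ n`
    rcases Nat.eq_zero_or_pos r with rfl | hr0
    · -- `r = 0`: `x` is primitive of degree `0` and `P = (0, 0)`
      obtain ⟨⟨a, t⟩, hat⟩ := P
      have ha : a = 0 := by omega
      have ht : t = 0 := by omega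
      subst ha; subst ht
      have hprim : x ∈ primitiveClasses κ n (2 * 0) := by
        rw [primitiveClasses_eq_ker κ n (by omega) (show 2 * 0 + (n + 1) = n + 1 by omega)
          (show 2 * 0 + 2 * (n + 1) = 2 * n + 2 by ring), LinearMap.mem_ker]
        haveI := hvan (2 * n + 2) (by omega)
        exact Subsingleton.elim _ _
      have h := primitivePart_lefschetzPowTo_of_mem hL hvan ⟨(2 * 0, 0), hat⟩ (by norm_num) hprim
      rw [lefschetzPowTo_zero_eq_id κ, LinearMap.id_apply] at h
      rw [h]
      exact hx
    · -- `r = r₀ + 1`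
      obtain ⟨r₀, rfl⟩ : ∃ r₀, r = r₀ + 1 := ⟨r - 1, by omega⟩
      -- `y = L^{n-2r+1} x ∈ N^{n-r₀}`, `= L^{n-2r₀} x₁` with `x₁ ∈ N^{r₀}` by `A`
      set e' := n - 2 * r₀ - 1 with he'
      have hy := lefschetzPowTo_mem_supportedClasses hX hκ rfl hx e' (2 * r₀ + 2 * (1 + e')) (by omega)
      obtain ⟨x₁, hx₁, hx₁y⟩ := exists_lefschetzPowTo_eq_of_surjOn
        (hA r₀ (1 + e') (r₀ + (1 + e')) (by omega) (by omega) (by omega) rfl) rfl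
        (by rw [show r₀ + (1 + e') = r₀ + 1 + e' by ring]; exact hy)
      -- `x₀ := x - L x₁` is primitive and algebraic
      set x₀ := x - lefschetzPowTo κ 1 (2 * r₀) (2 * (r₀ + 1)) (by ring) x₁ with hx₀
      have hx₀alg : x₀ ∈ algebraicClasses X (r₀ + 1) :=
        Submodule.sub_mem _ hx (lefschetzPowTo_mem_supportedClasses hX hκ rfl hx₁ 1 _ (by ring))
      have hx₀prim : x₀ ∈ primitiveClasses κ n (2 * (r₀ + 1)) := by
        rw [primitiveClasses_eq_ker κ n hr (show 2 * (r₀ + 1) + e' = n + 1 by omega)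
          (show 2 * (r₀ + 1) + 2 * e' = 2 * r₀ + 2 * (1 + e') by omega), LinearMap.mem_ker, hx₀, map_sub,
          lefschetzPowTo_lefschetzPowTo κ e' (show 2 * r₀ + 2 * 1 = 2 * (r₀ + 1) by ring)
            (show 2 * (r₀ + 1) + 2 * e' = 2 * r₀ + 2 * (1 + e') by omega) (show 2 * r₀ + 2 * (1 + e') = 2 * r₀ + 2 * (1 + e') from rfl) x₁,
          hx₁y, sub_self]
      -- decompose `ξ_P x = ξ_P x₀ + ξ_P (L x₁)`
      have hxdec : x = x₀ + lefschetzPowTo κ 1 (2 * r₀) (2 * (r₀ + 1)) (by ring) x₁ := by rw [hx₀]; abel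
      rw [hxdec, map_add]
      refine Submodule.add_mem _ ?_ ?_
      · -- the primitive term
        have hP₀2 : 2 * (r₀ + 1) + 2 * 0 = 2 * (r₀ + 1) := by ring
        have hmem : x₀ ∈ lefschetzSummand κ n (2 * (r₀ + 1)) ⟨(2 * (r₀ + 1), 0), hP₀2⟩ := by
          have h := lefschetzPowTo_mem_lefschetzSummand (κ := κ) (n := n) hP₀2 hx₀prim
          rwa [lefschetzPowTo_zero_eq_id κ, LinearMap.id_apply] at h
        by_cases hP : P = ⟨(2 * (r₀ + 1), 0), hP₀2⟩
        · subst hP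
          have h := primitivePart_lefschetzPowTo_of_mem hL hvan ⟨(2 * (r₀ + 1), 0), hP₀2⟩
            (by change 2 * (r₀ + 1) + 0 ≤ n; omega) hx₀prim
          rw [lefschetzPowTo_zero_eq_id κ, LinearMap.id_apply] at h
          rw [h]
          change x₀ ∈ supportedClasses X (2 * (r₀ + 1)) (r₀ + 1 - 0)
          exact hx₀alg
        · rw [primitivePart_eq_zero_of_mem_ne hL hvan (fun h ↦ hP h.symm) hmem]
          exact Submodule.zero_mem _
      · -- the shifted components of `x₁` (induction hypothesis in degree `2r₀`)
        have hA₀ : ∀ (p' r' q' : ℕ), p' < r₀ → p' + r₀ ≤ n → 2 * p' + r' = n → p' + r' = q' →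
            Set.SurjOn (lefschetzPow κ r' (2 * p')) (algebraicClasses X p' : Set (complexBetti X (2 * p')))
              (supportedClasses X (2 * p' + 2 * r') q') :=
          fun p' r' q' h1 h2 h3 h4 ↦ hA p' r' q' (by omega) (by omega) h3 h4
        have h := primitivePart_lefschetzPowTo_mem_supportedClasses hL hvan (i'' := 2 * r₀) (e := 1) (r'' := r₀)
          (by ring) (fun Q ↦ ih r₀ (by omega) hA₀ x₁ hx₁ Q) (fun Q ↦ by have := Q.2; omega) P
        rwa [show r₀ + 1 - P.1.2 = r₀ + 1 - P.1.2 from rfl] at h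
  · -- degrees `2r > n`
    rcases le_or_gt (2 * r) (2 * n) with hr2 | hr2
    · -- `x = L^{2r-n} x'` with `x' ∈ N^{n-r}` by `A`
      obtain ⟨x', hx', hx'x⟩ := exists_lefschetzPowTo_eq_of_surjOn
        (hA (n - r) (2 * r - n) (n - r + (2 * r - n)) (by omega) (by omega) (by omega) rfl)
        (m := 2 * r) (by omega) (y := x) (by rw [show n - r + (2 * r - n) = r by omega]; exact hx)
      rw [← hx'x]
      have hA' : ∀ (p' r' q' : ℕ), p' < n - r → p' + (n - r) ≤ n → 2 * p' + r' = n → p' + r' = q' →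
          Set.SurjOn (lefschetzPow κ r' (2 * p')) (algebraicClasses X p' : Set (complexBetti X (2 * p')))
            (supportedClasses X (2 * p' + 2 * r') q') :=
        fun p' r' q' h1 h2 h3 h4 ↦ hA p' r' q' (by omega) (by omega) h3 h4
      have h := primitivePart_lefschetzPowTo_mem_supportedClasses hL hvan (i'' := 2 * (n - r)) (e := 2 * r - n)
        (r'' := n - r) (by omega) (fun Q ↦ ih (n - r) (by omega) hA' x' hx' Q) (fun Q ↦ by have := Q.2; omega) P
      rwa [show n - r + (2 * r - n) - P.1.2 = r - P.1.2 by omega] at h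
    · -- `2r > 2n`: the cohomology vanishes
      haveI := hvan (2 * r) hr2
      rw [Subsingleton.elim x 0, map_zero]
      exact Submodule.zero_mem _

/-- Granted the surjectivity clause of `A(X, κ)` in the codimensions `p' < p`, `p' + p ≤ n` (`κ` the class of a
Kähler–rational datum), the Lefschetz terms `L^{s'} ξ_P x` of an algebraic class `x ∈ N^p` are algebraic of codimension
`q = n - p` (§2 and §1). [cite: Kleiman1968AlgebraicCycles, §3] -/
theorem lefschetzPowTo_primitivePart_mem_algebraicClasses_of_surjOn_lt (hX : IsSmoothProjective n X)
    (D : KaehlerRationalDatum n X) {p q : ℕ} (hpq : p + q = n)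
    (hA : ∀ (p' r' q' : ℕ), p' < p → p' + p ≤ n → 2 * p' + r' = n → p' + r' = q' →
      Set.SurjOn (lefschetzPow D.Hη r' (2 * p')) (algebraicClasses X p' : Set (complexBetti X (2 * p')))
        (supportedClasses X (2 * p' + 2 * r') q'))
    {x : complexBetti X (2 * p)} (hx : x ∈ algebraicClasses X p) (P : {P : ℕ × ℕ // P.1 + 2 * P.2 = 2 * p}) (s' : ℕ)
    (hs' : P.1.1 + P.1.2 + s' = n) (hq : P.1.1 + 2 * s' = 2 * q) :
    lefschetzPowTo D.Hη s' P.1.1 (2 * q) hq (primitivePart D.Hη n (D.hLℂ hX) (subsingleton_of_lt hX ℂ) P x) ∈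
      algebraicClasses X q := by
  have hP2 := P.2
  have hκ := (D.isPolarizationClass_Hη hX).mem_algebraicClasses
  have hξ := primitivePart_mem_supportedClasses_of_surjOn_lt hX hκ (D.hLℂ hX) (subsingleton_of_lt hX ℂ) p hA x hx P
  have h := lefschetzPowTo_mem_supportedClasses hX hκ (show 2 * (p - P.1.2) = P.1.1 by omega) hξ s' (2 * q) hq
  rwa [show p - P.1.2 + s' = q by omega] at h

/-- **"HOM ≡ NUM", LEFT, IN CODIMENSION `p`, GRANTED `A` BELOW `p`**: for `X` smooth projective of dimension `n`, `p + q = n`,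
and `κ` the class of a Kähler–rational datum `D` with the surjectivity clause of `A(X, κ)` in the codimensions `p' < p`,
`p' + p ≤ n`: an algebraic class `ξ ∈ N^p(X)` cup-orthogonal to `N^q(X)` vanishes — part XVIII-b's argument with `N` in
place of the Hodge spans (`Q_D(conj ξ, ·) = τ(z ∪ ·)` with `z ∈ N^q` by §2; second Hodge–Riemann relation for classes of
pure type `(p,p)`). Kleiman's `A(X) ∧ Hdg(X) ⇒ D(X)`, graded. [cite: Kleiman1968AlgebraicCycles, §3 Prop. 3.8 and Cor. 3.9]
[cite: VoisinHodgeI2002, §6.3.2 Thm. 6.32] -/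
theorem eq_zero_of_forall_cupProduct_algebraic_eq_zero_of_surjOn_lt (hX : IsSmoothProjective n X)
    (D : KaehlerRationalDatum n X) {p q : ℕ} (hpq : p + q = n)
    (hA : ∀ (p' r' q' : ℕ), p' < p → p' + p ≤ n → 2 * p' + r' = n → p' + r' = q' →
      Set.SurjOn (lefschetzPow D.Hη r' (2 * p')) (algebraicClasses X p' : Set (complexBetti X (2 * p')))
        (supportedClasses X (2 * p' + 2 * r') q'))
    {ξ : complexBetti X (2 * p)} (hξ : ξ ∈ algebraicClasses X p)
    (h : ∀ b ∈ algebraicClasses X q, cupProduct (show 2 * p + 2 * q = 2 * n by omega) ξ b = 0) : ξ = 0 := by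
  obtain ⟨A⟩ := nonempty_hodgeModel_holds hX
  have hI := hodgePQ_independent_of_hodgeModel_holds
  set x := conjClass (ComplexPoints X) (2 * p) ξ with hxdef
  have hx : x ∈ algebraicClasses X p := conjClass_mem_algebraicClasses hX hξ
  obtain ⟨z, hz, hQ⟩ := MotivatedAlgebra.exists_polarizationForm_eq_trace_cupProduct (D.hLℂ hX) (subsingleton_of_lt hX ℂ)
    (D.cTrace hX) (show 2 * q + 2 * p = 2 * n by omega) x _
    (fun P s' hs' hq ↦ lefschetzPowTo_primitivePart_mem_algebraicClasses_of_surjOn_lt hX D hpq hA hx P s' hs' hq)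
  have h0 : D.cform hX (2 * p) x (conjClass (ComplexPoints X) (2 * p) x) = 0 := by
    rw [hxdef, conjClass_conjClass ξ, ← hxdef, KaehlerRationalDatum.cform, hQ,
      cupProduct_gradedComm_holds ℂ (ComplexPoints X) (show 2 * q + 2 * p = 2 * n by omega)
        (show 2 * p + 2 * q = 2 * n by omega) z ξ, h z hz, smul_zero, map_zero]
  by_contra hξ0
  have hx0 : x ≠ 0 := by
    intro hx0
    apply hξ0
    rw [← conjClass_conjClass ξ, ← hxdef, hx0, conjClass_zero]
  have hpp : (p, p) ∈ Finset.HasAntidiagonal.antidiagonal (2 * p) := Finset.HasAntidiagonal.mem_antidiagonal.2 (by omega)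
  have hxA : x ∈ A.typePiece (2 * p) ⟨(p, p), hpp⟩ :=
    A.mem_typePiece_of_isOfHodgeType hI hX hpp (isOfHodgeType_of_mem_algebraicClasses_of_isSmoothProjective hX p hx)
  obtain ⟨r, hr, hQr⟩ := D.cform_conj_pos hX A hpp hxA hx0
  rw [h0, mul_zero] at hQr
  exact hr.ne' (by exact_mod_cast hQr.symm)

/-- **`A(X, κ) ⇒ D(X)`, LEFT: for `ξ ∈ N^p(X)` cup-orthogonal to `N^q(X)` (`p + q = n`), `ξ = 0`.**
[cite: Kleiman1968AlgebraicCycles, §3 Prop. 3.8 and Cor. 3.9] [cite: VoisinHodgeI2002, §6.3.2 Thm. 6.32] -/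
theorem eq_zero_of_forall_cupProduct_algebraic_eq_zero_of_standardConjectureA (hX : IsSmoothProjective n X)
    (D : KaehlerRationalDatum n X) (hA : StandardConjectureA n X D.Hη) {p q : ℕ} (hpq : p + q = n)
    {ξ : complexBetti X (2 * p)} (hξ : ξ ∈ algebraicClasses X p)
    (h : ∀ b ∈ algebraicClasses X q, cupProduct (show 2 * p + 2 * q = 2 * n by omega) ξ b = 0) : ξ = 0 :=
  eq_zero_of_forall_cupProduct_algebraic_eq_zero_of_surjOn_lt hX D hpq
    (fun p' r' q' _ _ h3 h4 ↦ (hA.2 p' r' q' h3 h4).surjOn) hξ h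

/-- **`A(X, κ) ⇒ D(X)`, RIGHT** (exchange `p`, `q`; graded commutativity in even degrees).
[cite: Kleiman1968AlgebraicCycles, §3 Prop. 3.8 and Cor. 3.9] -/
theorem eq_zero_of_forall_cupProduct_algebraic_eq_zero_of_standardConjectureA' (hX : IsSmoothProjective n X)
    (D : KaehlerRationalDatum n X) (hA : StandardConjectureA n X D.Hη) {p q : ℕ} (hpq : p + q = n)
    {b : complexBetti X (2 * q)} (hb : b ∈ algebraicClasses X q)
    (h0 : ∀ ξ ∈ algebraicClasses X p, cupProduct (show 2 * p + 2 * q = 2 * n by omega) ξ b = 0) : b = 0 := by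
  refine eq_zero_of_forall_cupProduct_algebraic_eq_zero_of_standardConjectureA hX D hA (show q + p = n by omega) hb
    fun ξ hξ ↦ ?_
  rw [cupProduct_gradedComm_holds ℂ (ComplexPoints X) (show 2 * q + 2 * p = 2 * n by omega)
    (show 2 * p + 2 * q = 2 * n by omega) b ξ, h0 ξ hξ, smul_zero]

/-- **`A(X, η)` FOR ALL POLARISATION CLASSES `⇒ D(X)`: the cup pairing `N^p(X) × N^q(X) → H^{2n}(X(ℂ); ℂ)` (`p + q = n`)
is non-degenerate on both sides** (take `η` the Kähler class of a Kähler–rational datum, a polarisation class by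
Lefschetz `(1,1)`). This is (Perf) of part XVIII-a for `X` a fibre, and — on a total space — the source of (Num).
[cite: Kleiman1968AlgebraicCycles, §3 Prop. 3.8 and Cor. 3.9] [cite: Grothendieck1968, §3 p. 196] -/
theorem nondegenerate_algebraicClasses_of_standardConjectureA (hX : IsSmoothProjective n X)
    (hA : ∀ η : complexBetti X 2, IsPolarizationClass n X η → StandardConjectureA n X η) {p q : ℕ} (hpq : p + q = n) :
    (∀ ξ ∈ algebraicClasses X p,
        (∀ b ∈ algebraicClasses X q, cupProduct (show 2 * p + 2 * q = 2 * n by omega) ξ b = 0) → ξ = 0) ∧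
      (∀ b ∈ algebraicClasses X q,
        (∀ ξ ∈ algebraicClasses X p, cupProduct (show 2 * p + 2 * q = 2 * n by omega) ξ b = 0) → b = 0) := by
  obtain ⟨D⟩ := nonempty_kaehlerRationalDatum hX
  have hA' := hA _ (D.isPolarizationClass_Hη hX)
  exact ⟨fun ξ hξ h ↦ eq_zero_of_forall_cupProduct_algebraic_eq_zero_of_standardConjectureA hX D hA' hpq hξ h,
    fun b hb h ↦ eq_zero_of_forall_cupProduct_algebraic_eq_zero_of_standardConjectureA' hX D hA' hpq hb h⟩

end Kleiman

end Part3

end Literature.AlgebraicGeometry.HodgeTheory.AbelianPencil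

end
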